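import Literature.NumberTheory.EllipticCurves.BSDWave0
import Literature.NumberTheory.EllipticCurves.HasseManin
import HarnessLib

/-!
# Discharge of `Literature.NumberTheory.EllipticCurves.hasse_bound` (bsd.S07; Hasse 1933/1936,
# Silverman *AEC* Thm. V.1.1)

D-0014 keeps `Literature/` free of unproved declarations by stating cited results as named facts
`def X : Prop`. The wave-0 BSD statement file `Literature.NumberTheory.EllipticCurves.BSDWave0`
states, for a Weierstrass curve `W` over a field `F` (inventory id **bsd.S07**),

* `Literature.NumberTheory.EllipticCurves.hasse_bound W`: if `F` is finite with `q` elements and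
  `W` is elliptic, `|(q + 1) - #W(F)| ≤ 2√q`, where `#W(F) = Nat.card W.toAffine.Point` counts the
  affine points together with the point at infinity.

The printed source (J. H. Silverman, *The Arithmetic of Elliptic Curves*, 2nd ed., GTM 106,
Springer 2009, Thm. V.1.1 (Hasse)): "Let `E/𝔽_q` be an elliptic curve defined over a finite field.
Then `|#E(𝔽_q) - q - 1| ≤ 2√q`."

This file discharges the fact from the tree THEOREM
`Literature.NumberTheory.EllipticCurves.HasseManin.abs_card_sub_le`
(`Literature.NumberTheory.EllipticCurves.HasseManin`, with `HasseManinFunctionField` and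
`HasseManinPolynomials`: the function-field form of Manin's elementary argument — Manin 1956;
Chahal–Soomro–Top 2014 — proved there sorry-free for every elliptic curve over every finite field,
in every characteristic), exactly as the sibling fact `Literature.NumberTheory.LFunctions.hasse_bound`
(rh.S36) was discharged in `Literature.NumberTheory.LFunctions.RHWave0HasseProofs`. The module
docstring of `HasseManin` names the present module as the intended home of this discharge; it had
not been filed. The only work here is bookkeeping: `[Finite F]` versus `[Fintype F]`
(`Fintype.ofFinite`, `Nat.card_eq_fintype_card`) and `|a - b| = |b - a|`.

* `Literature.NumberTheory.EllipticCurves.hasse_bound_holds W : hasse_bound W`.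

Pure proof file: no definitions, no named facts (net debt delta −1).

## References

* J. H. Silverman, *The Arithmetic of Elliptic Curves*, 2nd ed., GTM 106, Springer 2009,
  Thm. V.1.1. [SilvermanAEC2009]
* Ju. I. Manin, *On cubic congruences to a prime modulus*, Izv. Akad. Nauk SSSR Ser. Mat. 20
  (1956) 673–678.
* J. S. Chahal, A. Soomro, J. Top, *A supplement to Manin's proof of the Hasse inequality*, Rocky
  Mountain J. Math. 44 (2014) 1457–1470, §1.
-/

noncomputable section

namespace Literature.NumberTheory.EllipticCurves

open WeierstrassCurve

universe u

variable {F : Type u} [Field F] (W : WeierstrassCurve F)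

/-- **bsd.S07, discharge** (Hasse's theorem, the Riemann hypothesis for elliptic curves over
finite fields; Silverman, *AEC* 2nd ed., Thm. V.1.1: "Let `E/𝔽_q` be an elliptic curve defined
over a finite field. Then `|#E(𝔽_q) - q - 1| ≤ 2√q`."). The named fact
`Literature.NumberTheory.EllipticCurves.hasse_bound W` holds for every Weierstrass curve `W` over
every field `F`: for `F` finite and `W` elliptic it is
`Literature.NumberTheory.EllipticCurves.HasseManin.abs_card_sub_le W` (Manin's elementary argument
over the function field `F(W)`, uniform in the characteristic), read through
`Nat.card F = Fintype.card F` and `|a - b| = |b - a|`. [cite: SilvermanAEC2009, Thm. V.1.1] -/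
theorem hasse_bound_holds : hasse_bound W := by
  intro _ _
  letI : Fintype F := Fintype.ofFinite F
  rw [abs_sub_comm, Nat.card_eq_fintype_card (α := F)]
  exact HasseManin.abs_card_sub_le W

end Literature.NumberTheory.EllipticCurves

end
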